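import Summits.ValiantsHypothesis.ValiantsHypothesis.Theorems.VPBoundarySquareToricSlices
import Summits.ValiantsHypothesis.ValiantsHypothesis.Theorems.VPBoundarySquareCaseSplit
import Summits.ValiantsHypothesis.ValiantsHypothesis.Theorems.VPBoundarySquarePolyOrderCase
import Literature.Computability.AlgebraicComplexity.BorderComplexitySums
import Literature.Computability.AlgebraicComplexity.VPClosedUnderSum
import HarnessLib

/-!
# VP-boundary square — `ToricCompletion` IS «`VP` is closed»: the toric completion decided

Decomp lens-3 (border / debordering axis), g34, CALLED offer O-L3-10 (bus 1003). Route of record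
`route-ValiantsHypothesis-VPBoundarySquare` (`closes (Q) (P) : ValiantsHypothesis`;
`Q := EmptyBoundarySeparates`, `P := CollapseEmptiesBoundary`, `M := BoundaryOfVPNonempty`,
`U := ClosureDefinable`). `Theorems/VPBoundarySquareToricSlices` recorded
`@[conjecture] ToricCompletion` («every p-family in `closure(VP)` is, level by level, an exact
weight slice `weightedHomogeneousComponent w_n b_n f_n` of a `VP` family `f` ON THE SAME
VARIABLES») as an UNDECIDED corner of the completion ladder and as a «dichotomy lever»
`S ⟸ (Q ∧ TC) ∨ (P ∧ ¬TC)`. THIS FILE decides it relative to the square: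

★ `toricCompletion_iff_not_boundaryOfVPNonempty : ToricCompletion ↔ ¬ BoundaryOfVPNonempty` — as
typed, `ToricCompletion` is EQUIVALENT to «`VP` is closed on p-families» (`→` new; `←` is the
tree's `toricCompletion_of_boundaryEmpty`). Mechanism (elementary generic translation,
`vpClosed_of_toricCompletion`): replace a border p-family `g` by `g′_n := g_n + C a_n·(1 + Σ_j X_j)`
with `a_n` generic, so that the constant and all linear coefficients of `g′_n` are non-zero
(`exists_shift_family`); `g′` is again a p-family in `closure(VP)`; a weight slice containing the
monomials `1` and every `X_j` has `b = 0` and `w ≡ 0`, hence is the whole `VP` polynomial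
(`weightedHomogeneousComponent_eq_self_of_coeff_ne_zero`); so `g′ ∈ VP`, `g = g′ − C a_n·unit ∈ VP`:
`closure(VP) ∩ p-fam ⊆ {toric slices of VP} ⟺ closure(VP) ∩ p-fam ⊆ VP`. Record consequences
(§5): `valiant_iff_toricDichotomy` — the dichotomy lever is an `↔` and is literally the case split
on `M` of `Theorems/VPBoundarySquareCaseSplit` (`TC = ¬M`, no third lever);
`emptyBoundarySeparates_iff_vh_of_toricCompletion` — under `TC` the declared residual `Q` IS the
summit; `toricCompletion_iff_closureDefinable_of_not_vh` — short of `S`, `TC` is the lever `U`.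
UNAFFECTED: the toric RUNG `IsToricVPLimit.isVNPFamily`, `isVPBarFamily_initialForm`,
`valiant_and_boundary_of_toricEscape` (slices / initial forms of `VP` families stay `VNP` ∩ border
objects; only the COMPLETION statement collapses). The non-costume re-posing (PROJECTIONS of toric
initial forms in `poly(n)` EXTRA variables = GMQ16 §3.3's affine one-parameter degenerations with
sparse `t`-support) is a FORMAT statement between «`VP` closed» and `PresentableCompletion`,
recorded in the lineage node only (no new `def`, no new `Prop` here).

HONEST GRADE (sentence of record, critic bus 1003): elementary folklore-grade observation (generic
translation), kernel-new; value = DECISION retiring a lineage object: `ToricCompletion ≡ ¬M`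
(costume of `VP`-closedness as typed), bus 486's two tags corrected, offer O2 retired; 0 new
currency; rung 0; `VP ≠ VNP` untouched; `Q`/`P`/`M`/`U` unchanged.

References: Grochow–Mulmuley–Qiao 2016 (arXiv:1605.02815) §1, §3.3 (affine one-parameter
degenerations; `closure(VP)` = those of `VP` of exponential degree), §4.1 Thm. 7; Bürgisser 2024
(arXiv:2406.06217) Rem. 4.21, Def. 4.23; Bürgisser 2000 Def. 2.1–2.5; BLMW 2011 §9.3.
-/

noncomputable section

set_option linter.dupNamespace false

open MvPolynomial Finset
open Literature.Computability.AlgebraicComplexity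
open Summit.ValiantsHypothesis.ValiantsHypothesis.Theses.VPBoundarySquare
open Summit.ValiantsHypothesis.ValiantsHypothesis.Theorems.VPBoundarySquareToricSlices
open Summit.ValiantsHypothesis.ValiantsHypothesis.Theorems.VPBoundarySquareCaseSplit
open Summit.ValiantsHypothesis.ValiantsHypothesis.Theorems.VPBoundarySquarePolyOrderCase
  (isPBounded_of_isPFamily)

namespace Summit.ValiantsHypothesis.ValiantsHypothesis.Theorems.VPBoundarySquareToricCompletionClosed

/-! ### §1 A weight slice that sees `1` and every variable is the whole polynomial -/
/-- If the `(w, b)`-slice of `f` has a non-zero constant term and a non-zero coefficient at every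
`X j`, then `b = 0`, `w ≡ 0`, and the slice is `f` itself. [folklore] -/
theorem weightedHomogeneousComponent_eq_self_of_coeff_ne_zero {σ R : Type*} [CommSemiring R]
    (w : σ → ℕ) (b : ℕ) (f : MvPolynomial σ R)
    (h0 : coeff 0 (weightedHomogeneousComponent w b f) ≠ 0)
    (h1 : ∀ j, coeff (Finsupp.single j 1) (weightedHomogeneousComponent w b f) ≠ 0) :
    weightedHomogeneousComponent w b f = f := by
  classical
  have hb : b = 0 := by
    by_contra hb
    exact h0 (by rw [coeff_weightedHomogeneousComponent, if_neg (by rw [map_zero]; exact Ne.symm hb)])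
  have hw : ∀ j, w j = 0 := fun j => by
    by_contra hj
    exact h1 j (by rw [coeff_weightedHomogeneousComponent, if_neg (by
      rwa [Finsupp.weight_single, smul_eq_mul, one_mul, hb])])
  have hwt : ∀ d : σ →₀ ℕ, Finsupp.weight w d = b := fun d => by
    rw [hb, Finsupp.weight_apply, Finsupp.sum]
    exact Finset.sum_eq_zero fun i _ => by rw [hw i, smul_zero]
  ext d
  rw [coeff_weightedHomogeneousComponent, if_pos (hwt d)]

/-! ### §2 The generic affine translate `g + C a · (1 + Σ_j X_j)` -/
/-- A complex number avoiding finitely many forbidden translates. [folklore] -/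
theorem exists_shift_ne_zero {ι : Type*} (s : Finset ι) (c : ι → ℂ) :
    ∃ a : ℂ, ∀ i ∈ s, c i + a ≠ 0 := by
  classical
  obtain ⟨a, ha⟩ := Infinite.exists_notMem_finset (s.image fun i => -c i)
  exact ⟨a, fun i hi h => ha (Finset.mem_image.2 ⟨i, hi, by linear_combination (-1 : ℂ) * h⟩)⟩

/-- The affine unit `1 + Σ_j X_j` has constant term `1`. [folklore] -/
theorem coeff_zero_affineUnit (n : ℕ) :
    coeff 0 ((1 : MvPolynomial (Fin n) ℂ) + ∑ j, X j) = 1 := by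
  classical
  rw [coeff_add, coeff_sum, coeff_zero_one, Finset.sum_eq_zero, add_zero]
  intro j _
  rw [coeff_X, if_neg]
  exact Finsupp.single_ne_zero.2 one_ne_zero

/-- The affine unit `1 + Σ_i X_i` has coefficient `1` at every `X j`. [folklore] -/
theorem coeff_single_affineUnit {n : ℕ} (j : Fin n) :
    coeff (Finsupp.single j 1) ((1 : MvPolynomial (Fin n) ℂ) + ∑ i, X i) = 1 := by
  classical
  rw [coeff_add, coeff_sum, coeff_one, if_neg (Finsupp.single_ne_zero.2 one_ne_zero).symm, zero_add,
    Finset.sum_eq_single j]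
  · exact coeff_X_same j
  · intro i _ hij
    rw [coeff_X, if_neg]
    exact fun h => hij (Finsupp.single_left_injective one_ne_zero h)
  · exact fun h => absurd (Finset.mem_univ j) h

/-- Level by level, a generic translate of `g` has non-zero constant term and non-zero coefficient at
every variable. [folklore] -/
theorem exists_shift_family {v : ℕ → ℕ} (g : ∀ n, MvPolynomial (Fin (v n)) ℂ) :
    ∃ a : ℕ → ℂ, ∀ n, coeff 0 (g n + C (a n) * (1 + ∑ j, X j)) ≠ 0 ∧
      ∀ j : Fin (v n), coeff (Finsupp.single j 1) (g n + C (a n) * (1 + ∑ i, X i)) ≠ 0 := by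
  classical
  have key : ∀ n, ∃ a : ℂ, coeff 0 (g n) + a ≠ 0 ∧
      ∀ j : Fin (v n), coeff (Finsupp.single j 1) (g n) + a ≠ 0 := fun n => by
    obtain ⟨a, ha⟩ := exists_shift_ne_zero
      (insert (0 : Fin (v n) →₀ ℕ) (Finset.univ.image fun j : Fin (v n) => Finsupp.single j 1))
      (fun m => coeff m (g n))
    exact ⟨a, ha 0 (Finset.mem_insert_self _ _),
      fun j => ha _ (Finset.mem_insert_of_mem (Finset.mem_image_of_mem _ (Finset.mem_univ j)))⟩
  choose a ha using key
  exact ⟨a, fun n => ⟨by rw [coeff_add, coeff_C_mul, coeff_zero_affineUnit, mul_one]; exact (ha n).1,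
    fun j => by rw [coeff_add, coeff_C_mul, coeff_single_affineUnit, mul_one]; exact (ha n).2 j⟩⟩

/-- The affine unit family `(1 + Σ_j X_j)_n` is in `VP` (`L ≤ v n + 1`). [cite: Burgisser2000, Def. 2.4] -/
theorem isVPFamily_affineUnit {v : ℕ → ℕ} (hv : IsPBounded v) :
    IsVPFamily (fun n => (1 : MvPolynomial (Fin (v n)) ℂ) + ∑ j, X j) := by
  refine ⟨⟨hv.mono fun n => (Fintype.card_fin (v n)).le, (IsPBounded.const 1).mono fun n => ?_⟩, ?_⟩
  · refine (totalDegree_add _ _).trans (max_le ?_ (totalDegree_finsetSum_le fun j _ => ?_))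
    · rw [totalDegree_one]; exact Nat.zero_le _
    · exact (totalDegree_X (R := ℂ) j).le
  · refine (IsPBounded.add_holds hv (IsPBounded.const 1)).mono fun n => ?_
    have h1 : complexity (1 : MvPolynomial (Fin (v n)) ℂ) = 0 := by
      rw [← C_1]; exact complexity_C_holds (k := ℂ) (σ := Fin (v n)) 1
    have h2 : complexity (∑ j : Fin (v n), (X j : MvPolynomial (Fin (v n)) ℂ)) ≤ v n := by
      refine (complexity_finset_sum_le _ _).trans ?_
      rw [Finset.sum_eq_zero fun j _ => complexity_X_holds (k := ℂ) (σ := Fin (v n)) j, zero_add,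
        Finset.card_univ, Fintype.card_fin]
    calc complexity ((1 : MvPolynomial (Fin (v n)) ℂ) + ∑ j, X j)
        ≤ complexity (1 : MvPolynomial (Fin (v n)) ℂ) +
            complexity (∑ j : Fin (v n), (X j : MvPolynomial (Fin (v n)) ℂ)) + 1 :=
          complexity_add_le_holds _ _
      _ ≤ 0 + v n + 1 := by rw [h1]; exact Nat.add_le_add_right (Nat.add_le_add_left h2 0) 1
      _ = v n + 1 := by rw [zero_add]

/-- Translates of a p-family are p-families. [cite: Burgisser2000, Def. 2.3] -/
theorem isPFamily_shift {v : ℕ → ℕ} {g : ∀ n, MvPolynomial (Fin (v n)) ℂ} (hg : IsPFamily g)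
    (a : ℕ → ℂ) : IsPFamily (fun n => g n + C (a n) * (1 + ∑ j, X j)) := by
  have hu := ((isVPFamily_affineUnit (isPBounded_of_isPFamily hg)).C_mul a).1
  refine ⟨hg.1, (IsPBounded.add_holds hg.2 hu.2).mono fun n => ?_⟩
  exact (totalDegree_add _ _).trans (max_le (Nat.le_add_right _ _) (Nat.le_add_left _ _))

/-- `closure(VP)` is stable under `VP` translates. [cite: BurgisserEtAl2011, §9.3 (closure of VP)] -/
theorem isVPBarFamily_shift {v : ℕ → ℕ} {g : ∀ n, MvPolynomial (Fin (v n)) ℂ} (hpg : IsPFamily g)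
    (hg : IsVPBarFamily g) (a : ℕ → ℂ) :
    IsVPBarFamily (fun n => g n + C (a n) * (1 + ∑ j, X j)) := by
  have hu : IsVPFamily (fun n => C (a n) * ((1 : MvPolynomial (Fin (v n)) ℂ) + ∑ j, X j)) :=
    (isVPFamily_affineUnit (isPBounded_of_isPFamily hpg)).C_mul a
  have hubar : IsVPBarFamily (fun n => C (a n) * ((1 : MvPolynomial (Fin (v n)) ℂ) + ∑ j, X j)) :=
    hu.2.mono fun n => approxComplexity_le_complexity _
  exact hg.add hubar

/-! ### §3 Toric limits that see `1` and every variable are `VP` families -/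
/-- A toric limit of `VP` (same variables, exact slice) whose every level has non-zero constant
term and non-zero linear coefficients IS the `VP` family it is sliced from.
[cite: GrochowMulmuleyQiao2016, §3.3 (one-parameter degenerations; IsToricVPLimit omits the affine part)] -/
theorem isVPFamily_of_isToricVPLimit_of_coeff_ne_zero {v : ℕ → ℕ}
    {g : ∀ n, MvPolynomial (Fin (v n)) ℂ} (h : IsToricVPLimit v g) (h0 : ∀ n, coeff 0 (g n) ≠ 0)
    (h1 : ∀ n (j : Fin (v n)), coeff (Finsupp.single j 1) (g n) ≠ 0) : IsVPFamily g := by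
  obtain ⟨f, w, b, p, hf, -, -, -, hg⟩ := h
  have hgf : g = f := funext fun n => by
    rw [hg n]
    exact weightedHomogeneousComponent_eq_self_of_coeff_ne_zero (w n) (b n) (f n)
      (by rw [← hg n]; exact h0 n) fun j => by rw [← hg n]; exact h1 n j
  rw [hgf]; exact hf

/-! ### §4 ★ `ToricCompletion ↔ ¬ BoundaryOfVPNonempty` -/
/-- **`ToricCompletion ⟹ VP is closed on p-families`** (generic translation).
[cite: GrochowMulmuleyQiao2016, §1 (the question closure(VP) = VP) and §3.3] -/
theorem vpClosed_of_toricCompletion (h : ToricCompletion) :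
    ∀ (v : ℕ → ℕ) (g : ∀ n, MvPolynomial (Fin (v n)) ℂ), IsPFamily g → IsVPBarFamily g →
      IsPComputable g := by
  intro v g hpg hbar
  obtain ⟨a, ha⟩ := exists_shift_family g
  have hVP' : IsVPFamily (fun n => g n + C (a n) * ((1 : MvPolynomial (Fin (v n)) ℂ) + ∑ j, X j)) :=
    isVPFamily_of_isToricVPLimit_of_coeff_ne_zero
      (h v _ (isPFamily_shift hpg a) (isVPBarFamily_shift hpg hbar a)) (fun n => (ha n).1)
      (fun n j => (ha n).2 j)
  have hVP := hVP'.sub ((isVPFamily_affineUnit (isPBounded_of_isPFamily hpg)).C_mul a)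
  simp only [add_sub_cancel_right] at hVP
  exact hVP.2

/-- `ToricCompletion` ↔ the hypothesis of `Q` = the conclusion of `P`. [cite: GrochowMulmuleyQiao2016, §1] -/
theorem toricCompletion_iff_vpClosed :
    ToricCompletion ↔ ∀ (v : ℕ → ℕ) (g : ∀ n, MvPolynomial (Fin (v n)) ℂ), IsPFamily g →
      IsVPBarFamily g → IsPComputable g :=
  ⟨vpClosed_of_toricCompletion, toricCompletion_of_boundaryEmpty⟩

/-- ★ **`ToricCompletion ↔ ¬M`**: the toric completion statement, as typed, is «`VP` is closed».
[cite: GrochowMulmuleyQiao2016, §1 and §3.3] -/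
theorem toricCompletion_iff_not_boundaryOfVPNonempty : ToricCompletion ↔ ¬ BoundaryOfVPNonempty := by
  rw [toricCompletion_iff_vpClosed, not_boundaryOfVPNonempty_iff]

/-! ### §5 Consequences for the record -/
/-- Under `ToricCompletion` the declared residual `Q` IS the summit. [folklore] -/
theorem emptyBoundarySeparates_iff_vh_of_toricCompletion (h : ToricCompletion) :
    EmptyBoundarySeparates ↔ ValiantsHypothesis := by
  rw [emptyBoundarySeparates_iff_vh_or_boundary]
  exact ⟨fun hQ => hQ.resolve_right (toricCompletion_iff_not_boundaryOfVPNonempty.1 h), Or.inl⟩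

/-- **The «dichotomy lever» `S ⟸ (Q ∧ TC) ∨ (P ∧ ¬TC)` is an `↔` and is the case split on `M`.**
[cite: GrochowMulmuleyQiao2016, §1 (p. 3)] -/
theorem valiant_iff_toricDichotomy :
    ValiantsHypothesis ↔
      (EmptyBoundarySeparates ∧ ToricCompletion) ∨ (CollapseEmptiesBoundary ∧ ¬ ToricCompletion) := by
  rw [toricCompletion_iff_not_boundaryOfVPNonempty, not_not]
  constructor
  · intro hS
    by_cases hM : BoundaryOfVPNonempty
    · exact Or.inr ⟨collapseEmptiesBoundary_of_vh hS, hM⟩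
    · exact Or.inl ⟨emptyBoundarySeparates_of_vh hS, hM⟩
  · rintro (⟨hQ, hM⟩ | ⟨hP, hM⟩)
    · exact closes hQ (p_of_not_boundaryNonempty hM)
    · exact collapseEmptiesBoundary_iff_boundary_imp_vh.1 hP hM

/-- Short of `S`, `ToricCompletion` is the lever `U` itself. [cite: GrochowMulmuleyQiao2016, §1 (p. 3)] -/
theorem toricCompletion_iff_closureDefinable_of_not_vh (hS : ¬ ValiantsHypothesis) :
    ToricCompletion ↔ ClosureDefinable := by
  rw [toricCompletion_iff_not_boundaryOfVPNonempty, (of_not_vh hS).2.2, not_not]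

/-- `ToricCompletion ↔ U ∧ ¬M`. [cite: GrochowMulmuleyQiao2016, §1 (p. 3)] -/
theorem toricCompletion_iff_closureDefinable_and_not_boundary :
    ToricCompletion ↔ ClosureDefinable ∧ ¬ BoundaryOfVPNonempty :=
  ⟨fun h => ⟨closureDefinable_of_toricCompletion h, toricCompletion_iff_not_boundaryOfVPNonempty.1 h⟩,
    fun h => toricCompletion_iff_not_boundaryOfVPNonempty.2 h.2⟩

end Summit.ValiantsHypothesis.ValiantsHypothesis.Theorems.VPBoundarySquareToricCompletionClosed

end
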